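import Summits.HodgeConjecture.CorCM.Model.Universe
import Summits.HodgeConjecture.HodgeConjecture.Theorems.CorCMIsoCompleteIndexType
import Summits.HodgeConjecture.HodgeConjecture.Theses.RankFourFaces
import HarnessLib

/-!
# The SECOND model universe (model-2): the iso-complete Picard–CM universe `Model2.universe₂` over the
# tree `Universe` of record, its binder-free junction with `RankFourFaces.CMAbelianHodge`, and ladder
# compatibility with the model of record (`universe₂.PerL ↔ universeOf.PerL` by `Iff.rfl`)

Cell `pub-hodgecm2`, seat model-2 (gen 1 wrote it, gen 2 files it; FILING.md R2: `universe₂` is the second model, linked to the model of record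
`Model.universeOf` / `picardCMUniverse` by `perL_iff_universeOf`). Index type and junction: the landed
`Theorems/CorCMIsoCompleteIndexType.lean` (p228380). Everything here is a `def` by tree constructions or an
`Iff.rfl` / one-line junction; KERNEL over the records `hHD hI hU h₃`.
-/

noncomputable section

open scoped TensorProduct
open NumberField
open Literature.AlgebraicGeometry.Motives (CMType AbelianVariety)
open Literature.AlgebraicGeometry.Motives
open Literature.AlgebraicGeometry.Motives.HodgeStructure (EndAction conj ofRat)

namespace Summit.HodgeConjecture.CorCM

namespace Model2

open Literature.NumberTheory.Automorphic
open Literature.NumberTheory.Automorphic.PicardCM (BallQuotientUniformisedDatum CMAbelianVarietyRealised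
  BallQuotientUniformised ballQuotientUniformisedDatum_of)
open Summit.HodgeConjecture.CorCM
open Literature.AlgebraicGeometry.HodgeTheory
open Literature.AlgebraicGeometry.Milne1999 (CMHodgeHypothesisAt CodesHC)

variable (hHD : exists_isReal_hodgeModel) (hI : hodgePQ_independent_of_hodgeModel)
variable (hU : BallQuotientUniformisedDatum) (h₃ : CMAbelianVarietyRealised)

/-- The CM action on `H¹` of a CM code, read in the iso-complete universe: LITERALLY stage-1's
`Model.cmActOf` (the interpretation of `.cm c` is the same scheme `(cmRealisation h₃ c).A` in both index
types, and the smoothness witness is a proof of a `Prop`). [folklore] -/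
def cmActOf (c : PicardCM.CMCode) (K : Type) [Field K] [NumberField K] (e : K ≃+* c.E) :
    EndAction (BettiUniverse.hodge hHD (IsoComplete.Var.isSmoothProjective hU h₃ (.cm c)) 1) K :=
  Model.cmActOf hHD hI hU h₃ c K e

/-- **The iso-complete model universe (model-2)** over the records (ii-a′) `hU`, (iii) `h₃` and the Hodge
decomposition record `hHD` (+ `hI`, read by `cmAct` only): index type `IsoComplete.Var`; every other field is
the tree construction used by stage-1's `Model.universeOf`, composed with the model-2 interpretation
`IsoComplete.Var.scheme`; the content predicates are the INTRINSIC ones; `cmAV`, `cmAct`, `pms` are stage-1's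
codes and action VERBATIM. [folklore] -/
def universe₂ : Universe where
  Var := IsoComplete.Var
  dim := IsoComplete.Var.dim
  Coh := IsoComplete.Var.Coh hU h₃
  instFinite := IsoComplete.Var.finite hU h₃
  hodge X k := BettiUniverse.hodge hHD (IsoComplete.Var.isSmoothProjective hU h₃ X) k
  alg := IsoComplete.Var.alg hU h₃
  Mor := IsoComplete.Var.Mor hU h₃
  idMor := IsoComplete.Var.idMor hU h₃
  comp f g := IsoComplete.Var.comp hU h₃ f g
  pull f k := BettiUniverse.pull f k
  cup X i j := BettiUniverse.cup (IsoComplete.Var.scheme hU h₃ X) i j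
  tr X k := BettiUniverse.tr (IsoComplete.Var.isSmoothProjective hU h₃ X) k
  prod := IsoComplete.Var.prod
  fst := IsoComplete.Var.fst hU h₃
  snd := IsoComplete.Var.snd hU h₃
  IsAbelianVariety := IsoComplete.Var.IsAbelianVariety hU h₃
  IsCMAbelianVariety := IsoComplete.Var.IsCMAbelianVariety hU h₃
  cmAV K Φ := .cm (Model.cmCode K Φ)
  cmAct K Φ := cmActOf hHD hI hU h₃ (Model.cmCode K Φ) K (Model.cmCodeEquiv K Φ)
  pms L ι₁ V Γ := .pms (Model.pmsCode L ι₁ V Γ)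

/-- **The iso-complete Picard–CM model universe** over exactly the cited records (ii-a) `h₁`, (iii) `h₃`
(the `hU`-datum assembled by the tree's `ballQuotientUniformisedDatum_of`, as for stage-1's
`Model.picardCMUniverse`). [folklore] -/
def picardCMUniverse₂ (hHD : exists_isReal_hodgeModel) (hI : hodgePQ_independent_of_hodgeModel)
    (h₁ : BallQuotientUniformised) (h₃ : CMAbelianVarietyRealised) : Universe :=
  universe₂ hHD hI (ballQuotientUniformisedDatum_of h₁) h₃

/-! ### Junction lemmas (`rfl`) -/

section Junction

variable {hHD hI hU h₃}

/-- Junction (`rfl`): the varieties of the iso-complete universe are the codes `IsoComplete.Var`. -/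
@[simp] theorem universe₂_Var : (universe₂ hHD hI hU h₃).Var = IsoComplete.Var := rfl
/-- Junction (`rfl`): the dimension of a code is `IsoComplete.Var.dim`. -/
@[simp] theorem universe₂_dim (X : IsoComplete.Var) : (universe₂ hHD hI hU h₃).dim X = X.dim := rfl
/-- Junction (`rfl`): morphisms between codes are scheme morphisms between their interpretations. -/
theorem universe₂_Mor (X Y : IsoComplete.Var) :
    (universe₂ hHD hI hU h₃).Mor X Y = (IsoComplete.Var.scheme hU h₃ X ⟶ IsoComplete.Var.scheme hU h₃ Y) := rfl
/-- Junction (`rfl`): the CM abelian variety of `(K, Φ)` is the code `.cm (Model.cmCode K Φ)` — stage-1's code. -/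
@[simp] theorem universe₂_cmAV (K : CMField) (Φ : CMType K) :
    (universe₂ hHD hI hU h₃).cmAV K Φ = .cm (Model.cmCode K Φ) := rfl
/-- Junction (`rfl`): the Picard modular surface of `(L, ι₁, V, Γ)` is the code `.pms (Model.pmsCode L ι₁ V Γ)` — stage-1's code. -/
@[simp] theorem universe₂_pms (L : CMField) (ι₁ : L →+* ℂ) (V : HermSpace3 L ι₁) (Γ : Level V) :
    (universe₂ hHD hI hU h₃).pms L ι₁ V Γ = .pms (Model.pmsCode L ι₁ V Γ) := rfl

/-- The varieties the period statements READ are the same schemes in both universes: the Picard modular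
surface … -/
theorem scheme_pms_eq_universeOf (L : CMField) (ι₁ : L →+* ℂ) (V : HermSpace3 L ι₁) (Γ : Level V) :
    IsoComplete.Var.scheme hU h₃ ((universe₂ hHD hI hU h₃).pms L ι₁ V Γ) =
      PicardCM.Var.scheme hU h₃ ((Model.universeOf hHD hI hU h₃).pms L ι₁ V Γ) := rfl

/-- … and the CM abelian variety `A_{(K,Φ)}`. -/
theorem scheme_cmAV_eq_universeOf (K : CMField) (Φ : CMType K) :
    IsoComplete.Var.scheme hU h₃ ((universe₂ hHD hI hU h₃).cmAV K Φ) =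
      PicardCM.Var.scheme hU h₃ ((Model.universeOf hHD hI hU h₃).cmAV K Φ) := rfl

end Junction

/-! ### The E-term junction (model-2): KERNEL, no binder -/

/-- Stage-1's universe reading of COR-CM IS `Milne1999.CodesHC` (by `Iff.rfl`) — whose passage to the E-term
needs the binders `hDom`/`hIso` (or `hcor` + `hSimpleSub`) of `Milne1999/CMHodgeHypothesis*`. Recorded for
contrast. [folklore] -/
theorem universeOf_HC_CM_iff_codesHC :
    (Model.universeOf hHD hI hU h₃).HC_CM ↔ CodesHC hHD hU h₃ := Iff.rfl

/-- Model-2's universe reading of COR-CM IS `IsoComplete.CodesHC₂` (by `Iff.rfl`). [folklore] -/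
theorem HC_CM_iff_codesHC₂ : (universe₂ hHD hI hU h₃).HC_CM ↔ IsoComplete.CodesHC₂ hHD hU h₃ := Iff.rfl

/-- **`universe₂.HC_CM` ⟺ Milne's hypothesis (H)** — KERNEL (the only input besides the records is the tree
theorem `hI`, here the standing variable; see the primed form for the discharged statement). [folklore] -/
theorem HC_CM_iff_forall_cmHodgeHypothesisAt :
    (universe₂ hHD hI hU h₃).HC_CM ↔ ∀ A : AbelianVariety ℂ, CMHodgeHypothesisAt A :=
  (HC_CM_iff_codesHC₂ hHD hI hU h₃).trans (IsoComplete.codesHC₂_iff_forall_cmHodgeHypothesisAt hI)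

/-- **`universe₂.HC_CM` ⟺ the E-term `RankFourFaces.CMAbelianHodge` BY NAME** (stmt-HodgeConjecture-3052;
Milne's (H) is that item by `Iff.rfl`). [folklore] -/
theorem HC_CM_iff_CMAbelianHodge :
    (universe₂ hHD hI hU h₃).HC_CM ↔
      Summit.HodgeConjecture.HodgeConjecture.Theses.RankFourFaces.CMAbelianHodge :=
  HC_CM_iff_forall_cmHodgeHypothesisAt hHD hI hU h₃

/-- The same for the universe over the cited records (ii-a), (iii). [folklore] -/
theorem picardCMUniverse₂_HC_CM_iff_CMAbelianHodge (h₁ : BallQuotientUniformised) :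
    (picardCMUniverse₂ hHD hI h₁ h₃).HC_CM ↔
      Summit.HodgeConjecture.HodgeConjecture.Theses.RankFourFaces.CMAbelianHodge :=
  HC_CM_iff_CMAbelianHodge hHD hI _ h₃

/-! ### Ladder compatibility with stage 1: `PerL` (and the face-level period statements) are READ
IDENTICALLY in `universe₂` and in stage-1's `universeOf` — so a stage-1 proof of `PerL` for its model is
verbatim a proof of model-2's hypothesis. -/

/-- `PeriodNV` is the same proposition in both universes (same surface, same `A_{(K,Ψ i)}`, same
cohomology, cup product, trace and CM action). [folklore] -/
theorem periodNV_iff_universeOf {L : CMField} (ι₁ : L →+* ℂ) (V : HermSpace3 L ι₁) (K : CMField)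
    (Ψ : Fin 4 → CMType K) (σ : K →+* ℂ) :
    (universe₂ hHD hI hU h₃).PeriodNV ι₁ V K Ψ σ ↔ (Model.universeOf hHD hI hU h₃).PeriodNV ι₁ V K Ψ σ :=
  Iff.rfl

/-- **`universe₂.PerL ↔ universeOf.PerL`** (stage-1's `Universe.PerL`, the referee's pin, read in the two
model universes). [folklore] -/
theorem perL_iff_universeOf :
    (universe₂ hHD hI hU h₃).PerL ↔ (Model.universeOf hHD hI hU h₃).PerL := Iff.rfl

/-- `PerL44` likewise. [folklore] -/
theorem perL44_iff_universeOf :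
    (universe₂ hHD hI hU h₃).PerL44 ↔ (Model.universeOf hHD hI hU h₃).PerL44 := Iff.rfl

/-- `PeriodThmF` (the face-level period theorem, stage-1's binder of record for COR-CM) likewise. [folklore] -/
theorem periodThmF_iff_universeOf :
    (universe₂ hHD hI hU h₃).PeriodThmF ↔ (Model.universeOf hHD hI hU h₃).PeriodThmF := Iff.rfl

end Model2

end Summit.HodgeConjecture.CorCM

end
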